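import Summits.SmoothPoincare4.SmoothPoincare4.Theorems.EntropyRungNoncompactShrinkerGapTransplantDual
import Literature.Geometry.Riemannian.BakryEmeryHeatFlow

/-!
# Transplant comparison, V: the differential on `N × ℝ` and the gradient of a transplant

Helper file of the stub `stub_transplantComparison` (U3) of line `collapsed-ends-usc`, crux
`EntropyRung.NoncompactShrinkerGap` (stmt-SmoothPoincare4-10868): the fact-free change of variables
under a `(1 ± η)`-transplant `N × ℝ → M` (see
`EntropyRungNoncompactShrinkerGapStubTransplantComparison.lean` for the statement and the plan).

This file: `dW_{(y,t)}(v, s) = d_N W(·,t)_y(v) + s ∂_t W(y,·)(t)` (`mvfderiv_prod_apply`), the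
**gradient bound for a transplant** `|∇((W ∘ Ψ) 1_{Φ U})|²_g (Φ p) ≤ (1-η)⁻¹ (|∇_N W|²_h + (∂_t W)²)(p)`
(`gradSq_transplant_le`: `dw = dW ∘ dΨ`, `dΦ ∘ dΨ = id`, Cauchy–Schwarz twice and
`innerDual_comp_le`), joint continuity of `(y,t) ↦ ∂_t W(y,t)` (in charts) and of
`(y,t) ↦ |∇_N W(·,t)|²_h(y)` (the tree's `contMDiffOn_gradSq_family`), and the vanishing of both
off `tsupport W`.

## References

* H. Federer, *Geometric Measure Theory*, Springer 1969, §3.2.3 (area formula), §3.2.46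
  (Hausdorff measure of a Riemannian manifold). [Federer1969]
* I. Chavel, *Riemannian Geometry: A Modern Introduction*, 2nd ed., CUP 2006, §III.3, (III.3.6)
  (integration in local coordinates). [Chavel2006]
-/

noncomputable section

-- the prescribed namespace `Summit.<Summit>.<Problem>.…` repeats `SmoothPoincare4` (summit = problem)
set_option linter.dupNamespace false

namespace Summit.SmoothPoincare4.SmoothPoincare4.Theorems.NoncompactShrinkerGapTransplantComparison

open scoped Manifold ContDiff ENNReal NNReal Topology Bundle
open MeasureTheory Set
open Literature.Geometry.Lorentzian Literature.Geometry.Riemannian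


/-! ### The differential of a function on `N × ℝ` and the gradient of a transplant -/

section Gradient

variable {N : Type*} [TopologicalSpace N] [ChartedSpace E3 N]
  {M : Type*} [TopologicalSpace M] [ChartedSpace E4 M]

/-- **`dW_{(y,t)}(v, s) = d_N W(·,t)_y (v) + s ∂_t W(y,·)(t)`** for `W` differentiable at
`p = (y, t) ∈ N × ℝ` (chain rule along the slices `y' ↦ (y', t)`, `t' ↦ (y, t')`, whose
differentials are `inl`, `inr`). [folklore] -/
theorem mvfderiv_prod_apply {W : N × ℝ → ℝ} {p : N × ℝ}
    (hW : MDifferentiableAt ((𝓡 3).prod 𝓘(ℝ, ℝ)) 𝓘(ℝ, ℝ) W p) (v : E3) (s : ℝ) :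
    mvfderiv ((𝓡 3).prod 𝓘(ℝ, ℝ)) W p (v, s) =
      mvfderiv (𝓡 3) (fun y ↦ W (y, p.2)) p.1 v + s * deriv (fun t ↦ W (p.1, t)) p.2 := by
  have hi : MDifferentiableAt (𝓡 3) ((𝓡 3).prod 𝓘(ℝ, ℝ)) (fun y : N ↦ (y, p.2)) p.1 :=
    mdifferentiableAt_id.prodMk mdifferentiableAt_const
  have hj : MDifferentiableAt 𝓘(ℝ, ℝ) ((𝓡 3).prod 𝓘(ℝ, ℝ)) (fun t : ℝ ↦ (p.1, t)) p.2 :=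
    mdifferentiableAt_const.prodMk mdifferentiableAt_id
  have h1 : mvfderiv (𝓡 3) (fun y ↦ W (y, p.2)) p.1 v =
      mvfderiv ((𝓡 3).prod 𝓘(ℝ, ℝ)) W p (v, 0) := by
    have hc : mvfderiv (𝓡 3) (W ∘ fun y : N ↦ (y, p.2)) p.1 v =
        mvfderiv ((𝓡 3).prod 𝓘(ℝ, ℝ)) W (p.1, p.2)
          (mfderiv (𝓡 3) ((𝓡 3).prod 𝓘(ℝ, ℝ)) (fun y : N ↦ (y, p.2)) p.1 v) := by
      simp only [mvfderiv, ContinuousLinearMap.comp_apply]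
      rw [mfderiv_comp p.1 hW hi]
      rfl
    rw [mfderiv_prod_left] at hc
    exact hc
  have h2 : deriv (fun t ↦ W (p.1, t)) p.2 = mvfderiv ((𝓡 3).prod 𝓘(ℝ, ℝ)) W p (0, 1) := by
    have hc : mvfderiv 𝓘(ℝ, ℝ) (W ∘ fun t : ℝ ↦ (p.1, t)) p.2 1 =
        mvfderiv ((𝓡 3).prod 𝓘(ℝ, ℝ)) W (p.1, p.2)
          (mfderiv 𝓘(ℝ, ℝ) ((𝓡 3).prod 𝓘(ℝ, ℝ)) (fun t : ℝ ↦ (p.1, t)) p.2 1) := by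
      simp only [mvfderiv, ContinuousLinearMap.comp_apply]
      rw [mfderiv_comp p.2 hW hj]
      rfl
    rw [mfderiv_prod_right] at hc
    rw [← fderiv_apply_one_eq_deriv]
    refine Eq.trans ?_ hc
    simp only [mvfderiv, ContinuousLinearMap.comp_apply, mfderiv_eq_fderiv]
    rfl
  have e := (mvfderiv ((𝓡 3).prod 𝓘(ℝ, ℝ)) W p).map_add (v, 0) (s • ((0 : E3), (1 : ℝ)))
  have e2 := (mvfderiv ((𝓡 3).prod 𝓘(ℝ, ℝ)) W p).map_smul s ((0 : E3), (1 : ℝ))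
  have e4 := e.trans (congrArg (fun r ↦ mvfderiv ((𝓡 3).prod 𝓘(ℝ, ℝ)) W p (v, 0) + r)
    (e2.trans (smul_eq_mul _ _)))
  rw [h1, h2]
  convert e4 using 2
  change ((v, s) : E3 × ℝ) = ((v, (0 : ℝ)) : E3 × ℝ) + s • (((0 : E3), (1 : ℝ)) : E3 × ℝ)
  simp

variable [IsManifold (𝓡 3) ∞ N] [IsManifold (𝓡 4) ∞ M]

open Classical in
/-- **Gradient of a transplant**: for the transplant `w = (W ∘ Ψ) 1_{Φ U}` of a smooth `W` along
an `η`-transplant (`(1-η)(h(v,v)+s²) ≤ g(dΦ(v,s), dΦ(v,s))`, `Ψ ∘ Φ = id` on `U`), at `x = Φ p`: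
`|∇w|²_g(Φ p) ≤ (1-η)⁻¹ (|∇_N W(·,t)|²_h(y) + (∂_t W(y,t))²)`, `p = (y, t)`. Indeed
`dw_{Φ p} = dW_p ∘ dΨ_{Φ p}`, `dΦ_p ∘ dΨ_{Φ p} = id`, `dW_p(v,s)² ≤ (|∇_N W|² + (∂_t W)²)
(h(v,v) + s²)` (Cauchy–Schwarz twice) and `innerDual_comp_le`. [folklore] -/
theorem gradSq_transplant_le [T2Space M]
    (g : PseudoRiemannianMetric (𝓡 4) ∞ E4 (TangentSpace (𝓡 4) : M → Type _))
    (hg : g.IsRiemannian)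
    (h : PseudoRiemannianMetric (𝓡 3) ∞ E3 (TangentSpace (𝓡 3) : N → Type _))
    (hh : h.IsRiemannian) {U : Set (N × ℝ)} {Φ : N × ℝ → M} {Ψ : M → N × ℝ} {η : ℝ}
    (hη : η < 1) (hU : IsOpen U) (hΦ : ContMDiffOn ((𝓡 3).prod 𝓘(ℝ, ℝ)) (𝓡 4) ∞ Φ U)
    (hΦU : IsOpen (Φ '' U)) (hΨ : ContMDiffOn (𝓡 4) ((𝓡 3).prod 𝓘(ℝ, ℝ)) ∞ Ψ (Φ '' U))
    (hinv : ∀ p ∈ U, Ψ (Φ p) = p)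
    (hD : ∀ p ∈ U, ∀ (v : E3) (s : ℝ), (1 - η) * (h.val p.1 v v + s ^ 2) ≤
        g.val (Φ p) (mfderiv ((𝓡 3).prod 𝓘(ℝ, ℝ)) (𝓡 4) Φ p (v, s))
          (mfderiv ((𝓡 3).prod 𝓘(ℝ, ℝ)) (𝓡 4) Φ p (v, s)))
    {W : N × ℝ → ℝ} (hW : ContMDiff ((𝓡 3).prod 𝓘(ℝ, ℝ)) 𝓘(ℝ, ℝ) ∞ W) {p : N × ℝ} (hp : p ∈ U) :
    g.gradSq (fun x ↦ if x ∈ Φ '' U then W (Ψ x) else 0) (Φ p) ≤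
      (h.gradSq (fun y ↦ W (y, p.2)) p.1 + deriv (fun t ↦ W (p.1, t)) p.2 ^ 2) / (1 - η) := by
  set w : M → ℝ := fun x ↦ if x ∈ Φ '' U then W (Ψ x) else 0 with hw
  have h1η : 0 < 1 - η := by linarith
  have hev : w =ᶠ[𝓝 (Φ p)] (W ∘ Ψ) := by
    filter_upwards [hΦU.mem_nhds (mem_image_of_mem Φ hp)] with x hx
    simp only [hw, if_pos hx, Function.comp_apply]
  have hΨd : MDifferentiableAt (𝓡 4) ((𝓡 3).prod 𝓘(ℝ, ℝ)) Ψ (Φ p) :=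
    (hΨ.contMDiffAt (hΦU.mem_nhds (mem_image_of_mem Φ hp))).mdifferentiableAt (by simp)
  have hWd : MDifferentiableAt ((𝓡 3).prod 𝓘(ℝ, ℝ)) 𝓘(ℝ, ℝ) W p :=
    hW.mdifferentiableAt (by simp)
  have hWd' : MDifferentiableAt ((𝓡 3).prod 𝓘(ℝ, ℝ)) 𝓘(ℝ, ℝ) W (Ψ (Φ p)) := by
    rw [hinv p hp]; exact hWd
  -- `dw_{Φ p} = dW_p ∘ dΨ_{Φ p}`
  have e1 : mvfderiv (𝓡 4) w (Φ p) = mvfderiv (𝓡 4) (W ∘ Ψ) (Φ p) := by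
    simp only [mvfderiv]; rw [hev.mfderiv_eq]; rfl
  have hchain : mvfderiv (𝓡 4) (W ∘ Ψ) (Φ p) =
      (mvfderiv ((𝓡 3).prod 𝓘(ℝ, ℝ)) W (Ψ (Φ p))).comp
        (mfderiv (𝓡 4) ((𝓡 3).prod 𝓘(ℝ, ℝ)) Ψ (Φ p)) := by
    ext v
    simp only [mvfderiv, ContinuousLinearMap.comp_apply]
    rw [mfderiv_comp (Φ p) hWd' hΨd]
    rfl
  set F : N × ℝ → (TangentSpace (𝓡 4) (Φ p) →L[ℝ] ℝ) := fun p' ↦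
    (mvfderiv ((𝓡 3).prod 𝓘(ℝ, ℝ)) W p').comp (mfderiv (𝓡 4) ((𝓡 3).prod 𝓘(ℝ, ℝ)) Ψ (Φ p))
    with hF
  have hmv : mvfderiv (𝓡 4) w (Φ p) = F (Ψ (Φ p)) := e1.trans hchain
  rw [hinv p hp] at hmv
  -- the linear algebra
  set α : TangentSpace ((𝓡 3).prod 𝓘(ℝ, ℝ)) p →ₗ[ℝ] ℝ :=
    ((mvfderiv ((𝓡 3).prod 𝓘(ℝ, ℝ)) W p : TangentSpace ((𝓡 3).prod 𝓘(ℝ, ℝ)) p →L[ℝ] ℝ) :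
      TangentSpace ((𝓡 3).prod 𝓘(ℝ, ℝ)) p →ₗ[ℝ] ℝ) with hα_def
  set B : TangentSpace (𝓡 4) (Φ p) →ₗ[ℝ] TangentSpace ((𝓡 3).prod 𝓘(ℝ, ℝ)) p :=
    ((mfderiv (𝓡 4) ((𝓡 3).prod 𝓘(ℝ, ℝ)) Ψ (Φ p) :
      TangentSpace (𝓡 4) (Φ p) →L[ℝ] TangentSpace ((𝓡 3).prod 𝓘(ℝ, ℝ)) (Ψ (Φ p))) :
      TangentSpace (𝓡 4) (Φ p) →ₗ[ℝ] TangentSpace ((𝓡 3).prod 𝓘(ℝ, ℝ)) (Ψ (Φ p))) with hB_def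
  set A : TangentSpace ((𝓡 3).prod 𝓘(ℝ, ℝ)) p →ₗ[ℝ] TangentSpace (𝓡 4) (Φ p) :=
    ((mfderiv ((𝓡 3).prod 𝓘(ℝ, ℝ)) (𝓡 4) Φ p :
      TangentSpace ((𝓡 3).prod 𝓘(ℝ, ℝ)) p →L[ℝ] TangentSpace (𝓡 4) (Φ p)) :
      TangentSpace ((𝓡 3).prod 𝓘(ℝ, ℝ)) p →ₗ[ℝ] TangentSpace (𝓡 4) (Φ p)) with hA_def
  have hgrad : g.gradSq w (Φ p) = g.innerDual (Φ p) (α ∘ₗ B) (α ∘ₗ B) := by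
    simp only [PseudoRiemannianMetric.gradSq, hmv]
    rfl
  have hAB : ∀ w', A (B w') = w' := fun w' ↦ by
    have hid := mfderiv_comp_mfderiv_eq_id' hU hΦ hΦU hΨ hinv (by simp) hp
    exact congr($hid w')
  set K : ℝ := h.gradSq (fun y ↦ W (y, p.2)) p.1 + deriv (fun t ↦ W (p.1, t)) p.2 ^ 2 with hK
  have hG₁ : 0 ≤ h.gradSq (fun y ↦ W (y, p.2)) p.1 := hh.gradSq_nonneg _ _
  have hK0 : 0 ≤ K := add_nonneg hG₁ (sq_nonneg _)
  have hαb : ∀ v : TangentSpace ((𝓡 3).prod 𝓘(ℝ, ℝ)) p,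
      α v ^ 2 ≤ K * (h.val p.1 v.1 v.1 + v.2 ^ 2) := by
    intro v
    have hsplit : α v = mvfderiv (𝓡 3) (fun y ↦ W (y, p.2)) p.1 v.1 +
        v.2 * deriv (fun t ↦ W (p.1, t)) p.2 := mvfderiv_prod_apply hWd v.1 v.2
    set a := mvfderiv (𝓡 3) (fun y ↦ W (y, p.2)) p.1 v.1 with ha_def
    set d := deriv (fun t ↦ W (p.1, t)) p.2 with hd_def
    set G₁ := h.gradSq (fun y ↦ W (y, p.2)) p.1 with hG₁_def
    set q₁ := h.val p.1 v.1 v.1 with hq₁_def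
    have ha : a ^ 2 ≤ G₁ * q₁ := dual_apply_sq_le h hh p.1 _ v.1
    have hq₁ : 0 ≤ q₁ := h.val_self_nonneg hh p.1 v.1
    rw [hsplit]
    rcases hq₁.eq_or_lt with hq0 | hqpos
    · have ha0 : a = 0 := by
        rw [← hq0, mul_zero] at ha
        exact pow_eq_zero_iff (n := 2) (by norm_num) |>.1 (le_antisymm ha (sq_nonneg a))
      rw [ha0, ← hq0]
      nlinarith [mul_nonneg hG₁ (sq_nonneg v.2)]
    · have key : 0 ≤ q₁ * ((G₁ + d ^ 2) * (q₁ + v.2 ^ 2) - (a + v.2 * d) ^ 2) := by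
        nlinarith [sq_nonneg (a * v.2 - d * q₁), mul_nonneg (sub_nonneg.2 ha) (sq_nonneg v.2),
          mul_nonneg hq₁ (sub_nonneg.2 ha)]
      exact sub_nonneg.1 ((mul_nonneg_iff_of_pos_left hqpos).1 key)
  have hAbound : ∀ v : TangentSpace ((𝓡 3).prod 𝓘(ℝ, ℝ)) p,
      (1 - η) * (h.val p.1 v.1 v.1 + v.2 ^ 2) ≤ g.val (Φ p) (A v) (A v) := fun v ↦ hD p hp v.1 v.2
  have hmain := innerDual_comp_le g hg (Φ p) A B hAB (fun v ↦ h.val p.1 v.1 v.1 + v.2 ^ 2) h1η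
    hK0 hAbound α hαb
  rw [hgrad]
  exact hmain

omit [IsManifold (𝓡 3) ∞ N] in
/-- **`(y, t) ↦ ∂_t W(y, t)` is continuous** for `W` smooth on `N × ℝ`: in a chart `φ` of `N`,
`∂_t W(y, t) = D(W ∘ (φ⁻¹ × id))(φ y, t)(0, 1)`, a continuous function of `(φ y, t)`.
[folklore] -/
theorem continuous_deriv_slice [IsManifold (𝓡 3) ∞ N] {W : N × ℝ → ℝ}
    (hW : ContMDiff ((𝓡 3).prod 𝓘(ℝ, ℝ)) 𝓘(ℝ, ℝ) ∞ W) :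
    Continuous fun p : N × ℝ ↦ deriv (fun t ↦ W (p.1, t)) p.2 := by
  rw [continuous_iff_continuousAt]
  rintro ⟨y₀, t₀⟩
  set φ := extChartAt (𝓡 3) y₀ with hφ
  set eN : E3 × ℝ → N × ℝ := fun q ↦ (φ.symm q.1, q.2) with heN
  have hO : IsOpen (φ.target ×ˢ (univ : Set ℝ)) := (isOpen_extChartAt_target y₀).prod isOpen_univ
  have heNs : ContMDiffOn 𝓘(ℝ, E3 × ℝ) ((𝓡 3).prod 𝓘(ℝ, ℝ)) ∞ eN (φ.target ×ˢ univ) := by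
    have h1 : ContMDiffOn 𝓘(ℝ, E3 × ℝ) (𝓡 3) ∞ (fun q : E3 × ℝ ↦ φ.symm q.1)
        (φ.target ×ˢ univ) :=
      (contMDiffOn_extChartAt_symm y₀).comp contDiff_fst.contMDiff.contMDiffOn fun q hq ↦ hq.1
    exact h1.prodMk contDiff_snd.contMDiff.contMDiffOn
  have hWhat : ContDiffOn ℝ ∞ (W ∘ eN) (φ.target ×ˢ univ) :=
    contMDiffOn_iff_contDiffOn.1 (hW.comp_contMDiffOn heNs)
  have hcF : ContinuousOn (fun q ↦ fderiv ℝ (W ∘ eN) q ((0 : E3), (1 : ℝ))) (φ.target ×ˢ univ) :=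
    (hWhat.continuousOn_fderiv_of_isOpen hO (by simp)).clm_apply continuousOn_const
  have hrepr : ∀ p ∈ φ.source ×ˢ (univ : Set ℝ), deriv (fun t ↦ W (p.1, t)) p.2 =
      fderiv ℝ (W ∘ eN) (φ p.1, p.2) ((0 : E3), (1 : ℝ)) := by
    rintro ⟨y, t⟩ ⟨hy, -⟩
    have hfun : (fun t' ↦ W (y, t')) = (W ∘ eN) ∘ fun t' : ℝ ↦ (φ y, t') := by
      ext t'
      simp only [heN, Function.comp_apply, φ.left_inv hy]
    have hdiff : DifferentiableAt ℝ (W ∘ eN) (φ y, t) :=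
      (hWhat.differentiableOn (by simp)).differentiableAt
        (hO.mem_nhds ⟨φ.map_source hy, mem_univ _⟩)
    have hc : HasFDerivAt (fun t' : ℝ ↦ (φ y, t'))
        ((0 : ℝ →L[ℝ] E3).prod (ContinuousLinearMap.id ℝ ℝ)) t :=
      (hasFDerivAt_const (φ y) t).prodMk (hasFDerivAt_id t)
    have hcomp := (hdiff.hasFDerivAt.comp t hc).hasDerivAt.deriv
    change deriv (fun t' ↦ W (y, t')) t = fderiv ℝ (W ∘ eN) (φ y, t) ((0 : E3), (1 : ℝ))
    rw [hfun, hcomp]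
    simp
  have hψc : ContinuousOn (fun p : N × ℝ ↦ (φ p.1, p.2)) (φ.source ×ˢ univ) :=
    ((continuousOn_extChartAt y₀).comp continuousOn_fst fun p hp ↦ hp.1).prodMk continuousOn_snd
  have hon : ContinuousOn (fun p : N × ℝ ↦ deriv (fun t ↦ W (p.1, t)) p.2) (φ.source ×ˢ univ) :=
    (hcF.comp hψc fun p hp ↦ ⟨φ.map_source hp.1, mem_univ _⟩).congr fun p hp ↦ hrepr p hp
  exact hon.continuousAt
    (((isOpen_extChartAt_source y₀).prod isOpen_univ).mem_nhds ⟨mem_extChartAt_source y₀, mem_univ _⟩)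

/-- **`(y, t) ↦ |∇_N W(·, t)|²_h (y)` is continuous** for `W` smooth on `N × ℝ`
(`contMDiffOn_gradSq_family`). [folklore] -/
theorem continuous_gradSq_slice
    (h : PseudoRiemannianMetric (𝓡 3) ∞ E3 (TangentSpace (𝓡 3) : N → Type _))
    {W : N × ℝ → ℝ} (hW : ContMDiff ((𝓡 3).prod 𝓘(ℝ, ℝ)) 𝓘(ℝ, ℝ) ∞ W) :
    Continuous fun p : N × ℝ ↦ h.gradSq (fun y ↦ W (y, p.2)) p.1 := by
  have h1 : ContMDiffOn ((𝓡 3).prod 𝓘(ℝ, ℝ)) 𝓘(ℝ, ℝ) ∞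
      (fun p : N × ℝ ↦ (fun t y ↦ W (y, t)) p.2 p.1) (univ ×ˢ univ) := hW.contMDiffOn
  have h2 := contMDiffOn_gradSq_family h (f := fun t y ↦ W (y, t)) uniqueDiffOn_univ h1
  rw [univ_prod_univ, contMDiffOn_univ] at h2
  exact h2.continuous

/-- Off the topological support of `W` both slice derivatives vanish. [folklore] -/
theorem slice_derivs_eq_zero_of_notMem_tsupport
    (h : PseudoRiemannianMetric (𝓡 3) ∞ E3 (TangentSpace (𝓡 3) : N → Type _))
    {W : N × ℝ → ℝ} {p : N × ℝ} (hp : p ∉ tsupport W) :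
    h.gradSq (fun y ↦ W (y, p.2)) p.1 = 0 ∧ deriv (fun t ↦ W (p.1, t)) p.2 = 0 := by
  have hev : W =ᶠ[𝓝 p] fun _ ↦ 0 := notMem_tsupport_iff_eventuallyEq.1 hp
  have h1 : (fun y ↦ W (y, p.2)) =ᶠ[𝓝 p.1] fun _ ↦ 0 := by
    have hc : Filter.Tendsto (fun y : N ↦ (y, p.2)) (𝓝 p.1) (𝓝 p) :=
      (Continuous.prodMk_left p.2).continuousAt
    exact hc.eventually hev
  have h2 : (fun t ↦ W (p.1, t)) =ᶠ[𝓝 p.2] fun _ ↦ 0 := by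
    have hc : Filter.Tendsto (fun t : ℝ ↦ (p.1, t)) (𝓝 p.2) (𝓝 p) :=
      (Continuous.prodMk_right p.1).continuousAt
    exact hc.eventually hev
  refine ⟨gradSq_eq_zero_of_notMem_tsupport h (notMem_tsupport_iff_eventuallyEq.2 h1), ?_⟩
  rw [h2.deriv_eq, deriv_const]

end Gradient

/-! ### The registered sub-goal of this file -/

open Classical in
/-- **Registered sub-goal `stub_transplantGradient`** (the gradient of a transplant — the statement
of `gradSq_transplant_le` with all binders explicit):
`|∇((W ∘ Ψ) 1_{Φ U})|²_g (Φ p) ≤ (1-η)⁻¹ (|∇_N W(·,t)|²_h(y) + (∂_t W(y,t))²)`. [folklore] -/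
theorem stub_transplantGradient : ∀ (N : Type) [TopologicalSpace N] [ChartedSpace E3 N] [IsManifold (𝓡 3) ∞ N] (M : Type) [TopologicalSpace M] [ChartedSpace E4 M] [IsManifold (𝓡 4) ∞ M] [T2Space M] (g : PseudoRiemannianMetric (𝓡 4) ∞ E4 (TangentSpace (𝓡 4) : M → Type _)) (hg : g.IsRiemannian) (h : PseudoRiemannianMetric (𝓡 3) ∞ E3 (TangentSpace (𝓡 3) : N → Type _)) (hh : h.IsRiemannian) (U : Set (N × ℝ)) (Φ : N × ℝ → M) (Ψ : M → N × ℝ) (η : ℝ), η < 1 → IsOpen U → ContMDiffOn ((𝓡 3).prod 𝓘(ℝ, ℝ)) (𝓡 4) ∞ Φ U → IsOpen (Φ '' U) → ContMDiffOn (𝓡 4) ((𝓡 3).prod 𝓘(ℝ, ℝ)) ∞ Ψ (Φ '' U) → (∀ p ∈ U, Ψ (Φ p) = p) → (∀ p ∈ U, ∀ (v : E3) (s : ℝ), (1 - η) * (h.val p.1 v v + s ^ 2) ≤ g.val (Φ p) (mfderiv ((𝓡 3).prod 𝓘(ℝ, ℝ)) (𝓡 4) Φ p (v, s)) (mfderiv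 ((𝓡 3).prod 𝓘(ℝ, ℝ)) (𝓡 4) Φ p (v, s))) → ∀ (W : N × ℝ → ℝ), ContMDiff ((𝓡 3).prod 𝓘(ℝ, ℝ)) 𝓘(ℝ, ℝ) ∞ W → ∀ p ∈ U, g.gradSq (fun x ↦ if x ∈ Φ '' U then W (Ψ x) else 0) (Φ p) ≤ (h.gradSq (fun y ↦ W (y, p.2)) p.1 + deriv (fun t ↦ W (p.1, t)) p.2 ^ 2) / (1 - η) := by
  intro N _ _ _ M _ _ _ _ g hg h hh U Φ Ψ η hη hU hΦ hΦU hΨ hinv hD W hW p hp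
  exact gradSq_transplant_le g hg h hh hη hU hΦ hΦU hΨ hinv hD hW hp

end Summit.SmoothPoincare4.SmoothPoincare4.Theorems.NoncompactShrinkerGapTransplantComparison
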